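import Mathlib
import Summits.MatrixMultiplication.Statement
import Summits.MatrixMultiplication.MatrixMultiplication.Theorems.GraphEquationsDeepDeflation

/-!
# Graph equations — THE DISTINGUISHED MEMBERS ALONG THE MEMBERSHIP LADDER (M19f)

The exactness claim behind NODE-g32 rev 3 («on the e-ladder the generic-polar residual is
vacuous»), as kernel-checked algebra:

* `derivC_liftAB` — direction fields kill `ℂ[A,B]`: `D_μ ι(g) = 0`; `derivC_liftAB_mul`,
  `derivC_C_mul` — `D_μ (ι(g)·u) = ι(g)·D_μ u` (`D_μ` is `ℂ[A,B]`-linear).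
* `iterate_derivC_generator_pow` — **ITERATED DEFLATION OF A PURE POWER IS A PURE POWER WITH A
  `ℂ[A,B]`-MULTIPLIER**: for direction fields `μ₁, …, μ_L` (coefficients in `ℂ[A,B]`),
  `D_{μ₁}(D_{μ₂}(⋯ D_{μ_L}(f_q^{L+j}))) = (L+j)!/j! · ι(∏_i μ_i(q)) · f_q^j` EXACTLY — no cross
  terms, because the fields do not see the `c`-variables' coefficients `ι(μ_i(q))`.
* `iterate_derivC_generator_pow_pred` — the case `j = 1`: `e-1` steps turn the member `f_q^e` into
  `e! · ι(∏ μ_i(q)) · f_q`, a multiple of the generator by a function of `a, b` alone — a UNIT at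
  every base `y` where no `μ_i(q)` vanishes.  With `EqSystem.DeflatesTo.derivC_mem_span` (M19d)
  these are members of every system containing the iterated deflation.
-/

set_option linter.dupNamespace false

noncomputable section

open scoped BigOperators

namespace Summit.MatrixMultiplication.MatrixMultiplication.Theorems.GraphEquations

open MvPolynomial
open Literature.Computability.AlgebraicComplexity

variable {n : ℕ}

/-- Direction fields kill `ℂ[A,B]`: `D_μ ι(g) = 0`. -/
theorem derivC_liftAB (μ : Fin n × Fin n → MvPolynomial (MatMulVars n) ℂ)
    (g : MvPolynomial (MatMulVars n) ℂ) : derivC μ (liftAB n g) = 0 := by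
  simp [derivC, pderiv_inr_liftAB]

/-- `D_μ` is `ℂ[A,B]`-linear: `D_μ (ι(g)·u) = ι(g)·D_μ u`. -/
theorem derivC_liftAB_mul (μ : Fin n × Fin n → MvPolynomial (MatMulVars n) ℂ)
    (g : MvPolynomial (MatMulVars n) ℂ) (u : MvPolynomial (GraphVars n) ℂ) :
    derivC μ (liftAB n g * u) = liftAB n g * derivC μ u := by
  rw [derivC_mul, derivC_liftAB, zero_mul, zero_add]

/-- `D_μ (c·u) = c·D_μ u` for constants `c`. -/
theorem derivC_C_mul (μ : Fin n × Fin n → MvPolynomial (MatMulVars n) ℂ) (c : ℂ)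
    (u : MvPolynomial (GraphVars n) ℂ) : derivC μ (C c * u) = C c * derivC μ u := by
  rw [← liftAB_C (n := n) c, derivC_liftAB_mul]

/-- **ITERATED DEFLATION OF A PURE POWER.**  For direction fields `μ₁, …, μ_L` with coefficients
in `ℂ[A,B]`:  `D_{μ₁}(⋯(D_{μ_L}(f_q^{L+j}))⋯) = (L+j)!/j! · ι(∏_i μ_i(q)) · f_q^j`. -/
theorem iterate_derivC_generator_pow (q : Fin n × Fin n) :
    ∀ (μs : List (Fin n × Fin n → MvPolynomial (MatMulVars n) ℂ)) (j : ℕ),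
      μs.foldr (fun μ v => derivC μ v) (generator n q ^ (μs.length + j)) =
        C ((Nat.descFactorial (μs.length + j) μs.length : ℕ) : ℂ) *
          liftAB n ((μs.map fun μ => μ q).prod) * generator n q ^ j
  | [], j => by simp
  | μ :: μs, j => by
    have ih := iterate_derivC_generator_pow q μs (j + 1)
    have hdf : (μs.length + (j + 1)).descFactorial (μs.length + 1) =
        (j + 1) * (μs.length + (j + 1)).descFactorial μs.length := by
      rw [Nat.descFactorial_succ, Nat.add_sub_cancel_left]
    rw [List.foldr_cons, List.length_cons, show μs.length + 1 + j = μs.length + (j + 1) by ring, ih,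
      List.map_cons, List.prod_cons, hdf, mul_assoc, derivC_C_mul, derivC_liftAB_mul, derivC_pow_succ,
      derivC_generator]
    simp only [Nat.cast_mul, Nat.cast_add, Nat.cast_one, map_mul, map_add, map_one, map_natCast]
    ring

/-- **`e-1` steps: `f_q^e ↦ e!·ι(∏ μ_i(q))·f_q`** — the member of the iterated deflation is the
generator times a function of `a, b` alone. -/
theorem iterate_derivC_generator_pow_pred (q : Fin n × Fin n)
    (μs : List (Fin n × Fin n → MvPolynomial (MatMulVars n) ℂ)) :
    μs.foldr (fun μ v => derivC μ v) (generator n q ^ (μs.length + 1)) =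
      C ((Nat.factorial (μs.length + 1) : ℕ) : ℂ) * liftAB n ((μs.map fun μ => μ q).prod) *
        generator n q := by
  rw [iterate_derivC_generator_pow q μs 1, pow_one, Nat.descFactorial_eq_div (by omega),
    Nat.add_sub_cancel_left, Nat.factorial_one, Nat.div_one]

/-- At a base `y` where no `μ_i(q)` vanishes the multiplier is a unit: its value is
`e! · ∏ μ_i(q)(y) ≠ 0`. -/
theorem eval_multiplier_ne_zero (q : Fin n × Fin n) (y : MatMulVars n → ℂ)
    (μs : List (Fin n × Fin n → MvPolynomial (MatMulVars n) ℂ)) (hμ : ∀ μ ∈ μs, eval y (μ q) ≠ 0) :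
    eval y (C ((Nat.factorial (μs.length + 1) : ℕ) : ℂ) * (μs.map fun μ => μ q).prod) ≠ 0 := by
  rw [map_mul, eval_C, map_list_prod, List.map_map]
  refine mul_ne_zero (by exact_mod_cast Nat.factorial_ne_zero _) (List.prod_ne_zero ?_)
  intro h
  obtain ⟨μ, hμs, hμ0⟩ := List.mem_map.mp h
  exact hμ μ hμs hμ0

end Summit.MatrixMultiplication.MatrixMultiplication.Theorems.GraphEquations

end
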